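import Literature.NumberTheory.Automorphic.UnitaryGroupSelfDualLocus
import Literature.NumberTheory.Automorphic.UnitaryGroupLevelTransport
import Literature.NumberTheory.Automorphic.FixedCosetsStableLattices
import Literature.GroupTheory.OrbitIndexSum
import HarnessLib

/-!
# The ϖ-MODULAR locus of `GL_n(E_w)` is `U(J)(E_w) · S · GL_n(𝒪_w)`: the unitary group of a unimodular hermitian form admitting a
# scaling similitude `S` (`ᵗσ(S) J S = ϖ J`) is transitive on ϖ-modular lattices, and their stabilisers are the conjugates of
# `K¹ = U(J) ∩ S GL_n(𝒪) S⁻¹` (Jacobowitz 1962 §7; Kottwitz 1988 §2; the second vertex colour of the Bruhat–Tits tree of `U(1,1)`)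

Topic `NumberTheory/Automorphic`; namespace `Literature.NumberTheory.Automorphic.UnitaryGroup`.  KERNEL ONLY: theorems, no definition, no
instance, no notation, no named fact, no `sorry`.  Cell `pub/hodgecm-mathlib`, F0∕P3a road «R1LL-tree» (architect A-p16 (g27) RULING A-2 (d) «the
ϖ-MODULAR MIRROR» of ★ `UnitaryGroupSelfDualLocus`), consumed by the support localisation (U5)∕I-5 («`{g | tr g ∈ 𝒪_w} = ⋃_y yK⁰y⁻¹ ∪ ⋃_y yK¹y⁻¹`»:
the SECOND colour).  HONEST LABEL: HC_CM is proved only modulo the printed citations until rung 0 closes; nothing printed is asserted here —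
elementary lattice algebra over ★ Jacobowitz transitivity.

THE MIRROR.  ★ `UnitaryGroupSelfDualLocus` proves: for `J ∈ GL_n(𝒪)` `σ`-hermitian, every `g ∈ GL_n(E)` whose Gram matrix `ᵗσ(g) J g` is UNIMODULAR
(the lattice `g𝒪ⁿ` is SELF-DUAL) factors `g = u k`, `u ∈ U(J)`, `k ∈ GL_n(𝒪)`.  A lattice `g𝒪ⁿ` is `c`-MODULAR (`c = ϖ`: the other vertex type
of the tree of the quasi-split `U(1,1)`, [Kottwitz1988 §2]) when `ᵗσ(g) J g ∈ c · GL_n(𝒪)`.  If the form admits a SCALING SIMILITUDE `S ∈ GL_n(E)`,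
`ᵗσ(S) J S = c • J` (for the split plane `J₀ = antidiag(1,1)`: `S = diag(1, ϖ)`), then `ᵗσ(S⁻¹g) J (S⁻¹g) = c⁻¹ • ᵗσ(g) J g` is unimodular, so
`S⁻¹ g = u′ k` and `g = (S u′ S⁻¹) · S · k` with `S u′ S⁻¹ ∈ U(ᵗσ(S⁻¹) J S⁻¹) = U(c⁻¹ J) = U(J)`:
* §1 `formCongr_smul_right`, `formCongr_inv_eq_inv_smul_of_formCongr_eq_smul`, `conj_mem_unitaryGroupOfForm_of_formCongr_eq_smul` — bookkeeping;
* §2 **`exists_mem_unitaryGroupOfForm_mul_mul_of_modular_of_selfDualLocus`** — the factorisation `g = u S k` from the self-dual locus statement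
  taken as a HYPOTHESIS (so that every ★ specialisation of the self-dual file transfers verbatim), **`…_iff_of_selfDualLocus`** (the `c`-modular
  locus IS `U(J)·S·GL_n(𝒪)`), **`inv_mul_mem_and_conj_mem_glInt_of_mul_mul_eq_mul_mul`** (fibres: `u S k = u′ S k′ ⇒ u⁻¹u′ ∈ U(J)` and
  `S⁻¹(u⁻¹u′)S ∈ GL_n(𝒪)`, i.e. `u⁻¹u′ ∈ K¹ := U(J) ∩ S·GL_n(𝒪)·S⁻¹`, the stabiliser of the reference modular lattice `S𝒪ⁿ`);
* §3 LATTICE CURRENCY (★ `FixedCosetsStableLattices`: `Λ(g) = span 𝒪 (range (↑g)ᵀ)`): **`exists_mem_unitaryGroupOfForm_span_eq_of_modular_of_selfDualLocus`**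
  (every `c`-modular lattice is `Λ(u S)` for some `u ∈ U(J)` — TRANSITIVITY), **`map_span_eq_self_iff_conj_mem`** (`γ·Λ(uS) = Λ(uS) ↔ S⁻¹u⁻¹γuS ∈ GL_n(𝒪)`
  — STABILISER CONJUGACY: the stabiliser of `Λ(uS)` in `U(J)` is `u K¹ u⁻¹`);
  GROUP CURRENCY (what the vertex-frame lemma of the support localisation feeds: `ϖ•J′ = ᵗσ(g)Jg ∧ g⁻¹γg ∈ GL_n(𝒪)`):
  **`exists_mem_unitaryGroupOfForm_conj_mem_glInt_of_modular_of_selfDualLocus`** (`∃ u ∈ U(J), S⁻¹(u⁻¹γu)S ∈ GL_n(𝒪)`), its `K′`-token form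
  **`…_conj_mem_map_conj_…`** (`u⁻¹γu ∈ (GL_n(𝒪)).map (conj S)`, ★ `mem_map_conj_iff`) and, on the carrier `↥U(J)` with `K¹ := ((GL_n(𝒪)).map (conj S)).subgroupOf U(J)`,
  **`exists_eq_mul_mul_inv_of_modular_of_selfDualLocus`** (`γ = y k y⁻¹`, `k ∈ K¹` — «`γ ∈ ⋃_y yK¹y⁻¹`»);
* §4 the three dischargings of the self-dual hypothesis, mirroring ★ §1–§3 of the self-dual file: `…_of_modular` (Jacobowitz's (trace)+(norm)),
  `…_of_modular_of_isUnit_sub` (non-archimedean local field, `σ` residually non-trivial), `…_of_modular_of_nonsplit` (a non-split unramified place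
  of a quadratic extension of number fields);
* (sequel ★-to-be `UnitaryGroupModularLocusCM`: the carrier `(Φ₂)_w` at an unramified non-split CM place, `S = diag(1, ϖ_w)`.)

References: [Jacobowitz1962] R. Jacobowitz, *Hermitian forms over local fields*, Amer. J. Math. 84 (1962), §7 (modular lattices, Thm. 7.1);
[Kottwitz1988] R. E. Kottwitz, *Tamagawa numbers*, Ann. of Math. 127 (1988), §2 (the two vertex types of the tree of `U(1,1)`);
[Kottwitz1992] R. E. Kottwitz, *Points on some Shimura varieties over finite fields*, JAMS 5 (1992), Lemma 7.2, Cor. 7.3.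
-/

set_option autoImplicit false

open NumberField IsDedekindDomain
open scoped Matrix ValuativeRel

namespace Literature.NumberTheory.Automorphic.UnitaryGroup

open Literature.NumberTheory.Automorphic

/-! ## §1 Bookkeeping: scaling the form -/

section Bookkeeping

variable {R : Type*} [CommRing R] {n : ℕ} (σ : R →+* R)

/-- `ᵗσ(g)·(c•H)·g = c • ᵗσ(g)·H·g`: the form transport is linear in the form (any rank). [cite: Jacobowitz1962, §7] -/
theorem formCongr_smul_right (g : GL (Fin n) R) (c : R) (H : Matrix (Fin n) (Fin n) R) :
    formCongr σ g (c • H) = c • formCongr σ g H := by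
  simp only [formCongr, Matrix.mul_smul, Matrix.smul_mul]

/-- If `ᵗσ(S) H S = c • H` with `c` a unit then `ᵗσ(S⁻¹) H S⁻¹ = c⁻¹ • H` (the inverse of a similitude of multiplier `c` has multiplier `c⁻¹`).
[cite: Jacobowitz1962, §7] -/
theorem formCongr_inv_eq_inv_smul_of_formCongr_eq_smul {c : Rˣ} (S : GL (Fin n) R) (H : Matrix (Fin n) (Fin n) R)
    (hS : formCongr σ S H = (c : R) • H) : formCongr σ S⁻¹ H = ((c⁻¹ : Rˣ) : R) • H := by
  have h : formCongr σ S⁻¹ ((c : R) • H) = H := by rw [← hS, formCongr_inv_formCongr]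
  rw [formCongr_smul_right] at h
  have h' := congrArg (fun M : Matrix (Fin n) (Fin n) R => ((c⁻¹ : Rˣ) : R) • M) h
  simpa only [smul_smul, Units.inv_mul, one_smul] using h'

/-- **A similitude normalises the unitary group**: if `ᵗσ(S) H S = c • H` with `c` a unit, then `S u S⁻¹ ∈ U(H)` for every `u ∈ U(H)`
(`S u S⁻¹ ∈ U(ᵗσ(S⁻¹) H S⁻¹) = U(c⁻¹ • H) = U(H)`). [cite: Jacobowitz1962, §7] [cite: Kottwitz1988, §2] -/
theorem conj_mem_unitaryGroupOfForm_of_formCongr_eq_smul {c : Rˣ} (S : GL (Fin n) R) (H : Matrix (Fin n) (Fin n) R)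
    (hS : formCongr σ S H = (c : R) • H) {u : GL (Fin n) R} (hu : u ∈ unitaryGroupOfForm σ H) :
    S * u * S⁻¹ ∈ unitaryGroupOfForm σ H := by
  refine conj_mem_unitaryGroupOfForm σ S H ?_
  rwa [hS, unitaryGroupOfForm_smul_of_isUnit σ c.isUnit]

/-- Conversely `S⁻¹ u S ∈ U(H)` for `u ∈ U(H)` (apply the previous lemma to the similitude `S⁻¹` of multiplier `c⁻¹`). [cite: Jacobowitz1962, §7] -/
theorem inv_conj_mem_unitaryGroupOfForm_of_formCongr_eq_smul {c : Rˣ} (S : GL (Fin n) R) (H : Matrix (Fin n) (Fin n) R)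
    (hS : formCongr σ S H = (c : R) • H) {u : GL (Fin n) R} (hu : u ∈ unitaryGroupOfForm σ H) :
    S⁻¹ * u * S ∈ unitaryGroupOfForm σ H := by
  have h := conj_mem_unitaryGroupOfForm_of_formCongr_eq_smul σ S⁻¹ H (formCongr_inv_eq_inv_smul_of_formCongr_eq_smul σ S H hS) hu
  rwa [inv_inv] at h

end Bookkeeping

/-! ## §2 The `c`-modular locus is `U(J) · S · GL_n(𝒪)` (the self-dual locus statement as a hypothesis) -/

section Generic

variable {E : Type*} [Field E] [ValuativeRel E] (σ : E →+* E) {n : ℕ}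

/-- **THE ϖ-MODULAR MIRROR (factorisation)**: let `J` be a form for which the SELF-DUAL LOCUS statement holds (`ᵗσ(h) J h` unimodular ⇒
`h ∈ U(J)·GL_n(𝒪)`, ★ `exists_mem_unitaryGroupOfForm_mul_of_selfDual` and its specialisations), and `S` a scaling similitude `ᵗσ(S) J S = c • J`,
`c ≠ 0`.  Then every `g` whose Gram matrix lies in `c · GL_n(𝒪)` (the lattice `g𝒪ⁿ` is `c`-MODULAR) factors `g = u · S · k` with `u ∈ U(J)`,
`k ∈ GL_n(𝒪)`.  (`ᵗσ(S⁻¹g) J (S⁻¹g) = c⁻¹ • ᵗσ(g) J g` is unimodular, so `S⁻¹g = u′k`, and `S u′ S⁻¹ ∈ U(c⁻¹J) = U(J)`.)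
[cite: Jacobowitz1962, §7 Thm. 7.1] [cite: Kottwitz1988, §2] -/
theorem exists_mem_unitaryGroupOfForm_mul_mul_of_modular_of_selfDualLocus (J : Matrix (Fin n) (Fin n) E) {c : E} (hc : c ≠ 0)
    (S : GL (Fin n) E) (hS : formCongr σ S J = c • J)
    (hsd : ∀ h : GL (Fin n) E, (∃ J' ∈ glInt n E, (J' : Matrix (Fin n) (Fin n) E) = formCongr σ h J) →
      ∃ u ∈ unitaryGroupOfForm σ J, ∃ k ∈ glInt n E, h = u * k)
    (g : GL (Fin n) E) (hg : ∃ J' ∈ glInt n E, c • (J' : Matrix (Fin n) (Fin n) E) = formCongr σ g J) :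
    ∃ u ∈ unitaryGroupOfForm σ J, ∃ k ∈ glInt n E, g = u * S * k := by
  obtain ⟨J', hJ', hgJ⟩ := hg
  have hS' : formCongr σ S J = ((Units.mk0 c hc : Eˣ) : E) • J := hS
  have hSinv : formCongr σ S⁻¹ J = c⁻¹ • J := by
    rw [formCongr_inv_eq_inv_smul_of_formCongr_eq_smul σ S J hS']; rfl
  have hg' : ∃ J'' ∈ glInt n E, (J'' : Matrix (Fin n) (Fin n) E) = formCongr σ (S⁻¹ * g) J := by
    refine ⟨J', hJ', ?_⟩
    rw [formCongr_mul_eq_formCongr_formCongr, hSinv, formCongr_smul_right, ← hgJ, smul_smul, inv_mul_cancel₀ hc, one_smul]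
  obtain ⟨u', hu', k, hk, hSg⟩ := hsd (S⁻¹ * g) hg'
  refine ⟨S * u' * S⁻¹, conj_mem_unitaryGroupOfForm_of_formCongr_eq_smul σ S J hS' hu', k, hk, ?_⟩
  rw [inv_mul_cancel_right, mul_assoc, ← hSg, mul_inv_cancel_left]

/-- **The `c`-modular locus IS `U(J) · S · GL_n(𝒪)`**: under the self-dual locus hypothesis, with `J ∈ GL_n(𝒪)` and `σ` preserving `𝒪`, `g = u S k`
(`u ∈ U(J)`, `k ∈ GL_n(𝒪)`) IFF `ᵗσ(g) J g ∈ c · GL_n(𝒪)` — the converse because `ᵗσ(uSk) J (uSk) = ᵗσ(k) (c • J) k = c • ᵗσ(k) J k` and `GL_n(𝒪)`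
preserves unimodular Gram matrices (★ `exists_mem_glInt_coe_eq_formCongr`). [cite: Jacobowitz1962, §7 Thm. 7.1] [cite: Kottwitz1992, §7 Cor. 7.3] -/
theorem exists_mem_unitaryGroupOfForm_mul_mul_iff_of_selfDualLocus (hσO : ∀ x : 𝒪[E], σ x ∈ 𝒪[E])
    (J : GL (Fin n) E) (hJ : J ∈ glInt n E) {c : E} (hc : c ≠ 0)
    (S : GL (Fin n) E) (hS : formCongr σ S (J : Matrix (Fin n) (Fin n) E) = c • (J : Matrix (Fin n) (Fin n) E))
    (hsd : ∀ h : GL (Fin n) E, (∃ J' ∈ glInt n E, (J' : Matrix (Fin n) (Fin n) E) = formCongr σ h (J : Matrix (Fin n) (Fin n) E)) →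
      ∃ u ∈ unitaryGroupOfForm σ (J : Matrix (Fin n) (Fin n) E), ∃ k ∈ glInt n E, h = u * k)
    (g : GL (Fin n) E) :
    (∃ u ∈ unitaryGroupOfForm σ (J : Matrix (Fin n) (Fin n) E), ∃ k ∈ glInt n E, g = u * S * k) ↔
      ∃ J' ∈ glInt n E, c • (J' : Matrix (Fin n) (Fin n) E) = formCongr σ g (J : Matrix (Fin n) (Fin n) E) := by
  refine ⟨?_, exists_mem_unitaryGroupOfForm_mul_mul_of_modular_of_selfDualLocus σ (J : Matrix (Fin n) (Fin n) E) hc S hS hsd g⟩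
  rintro ⟨u, hu, k, hk, rfl⟩
  obtain ⟨J', hJ', hJ'k⟩ := exists_mem_glInt_coe_eq_formCongr σ hσO J hJ k hk
  refine ⟨J', hJ', ?_⟩
  rw [formCongr_mul_eq_formCongr_formCongr, formCongr_mul_eq_formCongr_formCongr,
    show formCongr σ u (J : Matrix (Fin n) (Fin n) E) = J from mem_unitaryGroupOfForm_iff.1 hu, hS, formCongr_smul_right, hJ'k]

omit [ValuativeRel E] in
/-- Group algebra: `u S k = u′ S k′` forces `S⁻¹ (u⁻¹ u′) S = k k′⁻¹`. [folklore] -/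
private theorem inv_mul_conj_eq_of_mul_mul_eq_mul_mul {S u u' k k' : GL (Fin n) E} (h : u * S * k = u' * S * k') :
    S⁻¹ * (u⁻¹ * u') * S = k * k'⁻¹ := by
  have h1 : u⁻¹ * u' = S * k * k'⁻¹ * S⁻¹ := by
    rw [inv_mul_eq_iff_eq_mul]
    calc u' = u' * S * k' * k'⁻¹ * S⁻¹ := by rw [mul_inv_cancel_right, mul_inv_cancel_right]
      _ = u * S * k * k'⁻¹ * S⁻¹ := by rw [h]
      _ = u * (S * k * k'⁻¹ * S⁻¹) := by simp only [mul_assoc]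
  rw [h1]
  simp only [mul_assoc, inv_mul_cancel_left, inv_mul_cancel, mul_one]

omit [ValuativeRel E] in
/-- **Fibres of `(u, k) ↦ u S k`**: `u S k = u′ S k′` with `u, u′ ∈ U(J)`, `k, k′ ∈ GL_n(𝒪)` forces `u⁻¹ u′ ∈ U(J)` AND `S⁻¹ (u⁻¹ u′) S ∈ GL_n(𝒪)`, i.e.
`u⁻¹ u′ ∈ K¹ := U(J) ∩ S · GL_n(𝒪) · S⁻¹` — the stabiliser IN `U(J)` of the reference modular lattice `S𝒪ⁿ`; so `u ↦ u S 𝒪ⁿ` identifies `U(J) ∕ K¹` with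
the `c`-modular lattices (the ϖ-modular twin of [Kottwitz1992, §7 p. 397]). [cite: Kottwitz1992, §7 Cor. 7.3] [cite: Kottwitz1988, §2] -/
theorem inv_mul_mem_and_conj_mem_glInt_of_mul_mul_eq_mul_mul [ValuativeRel E] {J : Matrix (Fin n) (Fin n) E} {S u u' k k' : GL (Fin n) E}
    (hu : u ∈ unitaryGroupOfForm σ J) (hu' : u' ∈ unitaryGroupOfForm σ J) (hk : k ∈ glInt n E) (hk' : k' ∈ glInt n E)
    (h : u * S * k = u' * S * k') : u⁻¹ * u' ∈ unitaryGroupOfForm σ J ∧ S⁻¹ * (u⁻¹ * u') * S ∈ glInt n E := by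
  refine ⟨mul_mem (inv_mem hu) hu', ?_⟩
  rw [inv_mul_conj_eq_of_mul_mul_eq_mul_mul h]
  exact mul_mem hk (inv_mem hk')

/-! ## §3 Lattice currency: transitivity on `c`-modular lattices and conjugacy of their stabilisers -/

/-- **TRANSITIVITY ON `c`-MODULAR LATTICES**: under the self-dual locus hypothesis and a scaling similitude `S` (`ᵗσ(S) J S = c • J`, `c ≠ 0`), every
lattice `Λ(g) = span 𝒪 (range (↑g)ᵀ)` with `c`-modular Gram matrix (`ᵗσ(g) J g ∈ c · GL_n(𝒪)`) is `Λ(u S)` for some `u ∈ U(J)` — the `U(J)`-translate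
`u · Λ(S)` of the REFERENCE modular lattice `Λ(S) = S𝒪ⁿ` (★ `span_range_transpose_eq_iff`: `Λ(uSk) = Λ(uS)` as `k ∈ GL_n(𝒪)`).
[cite: Jacobowitz1962, §7 Thm. 7.1] [cite: Kottwitz1988, §2] -/
theorem exists_mem_unitaryGroupOfForm_span_eq_of_modular_of_selfDualLocus (J : Matrix (Fin n) (Fin n) E) {c : E} (hc : c ≠ 0)
    (S : GL (Fin n) E) (hS : formCongr σ S J = c • J)
    (hsd : ∀ h : GL (Fin n) E, (∃ J' ∈ glInt n E, (J' : Matrix (Fin n) (Fin n) E) = formCongr σ h J) →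
      ∃ u ∈ unitaryGroupOfForm σ J, ∃ k ∈ glInt n E, h = u * k)
    (g : GL (Fin n) E) (hg : ∃ J' ∈ glInt n E, c • (J' : Matrix (Fin n) (Fin n) E) = formCongr σ g J) :
    ∃ u ∈ unitaryGroupOfForm σ J,
      Submodule.span 𝒪[E] (Set.range ((g : Matrix (Fin n) (Fin n) E))ᵀ) =
        Submodule.span 𝒪[E] (Set.range (((u * S : GL (Fin n) E) : Matrix (Fin n) (Fin n) E))ᵀ) := by
  obtain ⟨u, hu, k, hk, rfl⟩ := exists_mem_unitaryGroupOfForm_mul_mul_of_modular_of_selfDualLocus σ J hc S hS hsd g hg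
  refine ⟨u, hu, ?_⟩
  have hk' : (u * S * k)⁻¹ * (u * S) = k⁻¹ := by
    simp only [mul_inv_rev, mul_assoc, inv_mul_cancel_left, inv_mul_cancel, mul_one]
  rw [span_range_transpose_eq_iff, hk']
  exact inv_mem hk

omit [ValuativeRel E] in
/-- Group algebra: `(uS)⁻¹ γ (uS) = S⁻¹ (u⁻¹ γ u) S`. [folklore] -/
private theorem mul_inv_mul_mul_eq (S u γ : GL (Fin n) E) : (u * S)⁻¹ * γ * (u * S) = S⁻¹ * (u⁻¹ * γ * u) * S := by
  rw [mul_inv_rev]; simp only [mul_assoc]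

/-- **STABILISER CONJUGACY**: `γ · Λ(uS) = Λ(uS) ↔ S⁻¹ (u⁻¹ γ u) S ∈ GL_n(𝒪)` — the stabiliser of the modular lattice `u · Λ(S)` is `u K¹ u⁻¹` with
`K¹ = S · GL_n(𝒪) · S⁻¹` (intersected with `U(J)` for `γ ∈ U(J)`; ★ `map_span_range_transpose_eq_self_iff`).  With §3's transitivity: an element of
`U(J)` stabilising SOME `c`-modular lattice lies in SOME conjugate `u K¹ u⁻¹`, `u ∈ U(J)` — the second colour of the support localisation
`{tr g ∈ 𝒪} = ⋃ yK⁰y⁻¹ ∪ ⋃ yK¹y⁻¹`. [cite: Kottwitz1988, §2] [cite: Kottwitz1986, §3] -/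
theorem map_span_eq_self_iff_conj_mem (S u γ : GL (Fin n) E) :
    (Submodule.span 𝒪[E] (Set.range (((u * S : GL (Fin n) E) : Matrix (Fin n) (Fin n) E))ᵀ)).map
        ((Matrix.toLin' (γ : Matrix (Fin n) (Fin n) E)).restrictScalars 𝒪[E]) =
      Submodule.span 𝒪[E] (Set.range (((u * S : GL (Fin n) E) : Matrix (Fin n) (Fin n) E))ᵀ) ↔
      S⁻¹ * (u⁻¹ * γ * u) * S ∈ glInt n E := by
  rw [map_span_range_transpose_eq_self_iff, mul_inv_mul_mul_eq]

/-- **THE SECOND COLOUR, assembled**: under the self-dual locus hypothesis and a scaling similitude, if `γ` stabilises a `c`-modular lattice `Λ(g)`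
then `γ ∈ u · (S·GL_n(𝒪)·S⁻¹) · u⁻¹` for some `u ∈ U(J)`: `∃ u ∈ U(J), S⁻¹ (u⁻¹ γ u) S ∈ GL_n(𝒪)` (and `u⁻¹ γ u ∈ U(J)` when `γ ∈ U(J)`).
[cite: Kottwitz1988, §2] [cite: Jacobowitz1962, §7 Thm. 7.1] -/
theorem exists_mem_unitaryGroupOfForm_conj_mem_glInt_of_map_span_eq_self_of_selfDualLocus (J : Matrix (Fin n) (Fin n) E) {c : E}
    (hc : c ≠ 0) (S : GL (Fin n) E) (hS : formCongr σ S J = c • J)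
    (hsd : ∀ h : GL (Fin n) E, (∃ J' ∈ glInt n E, (J' : Matrix (Fin n) (Fin n) E) = formCongr σ h J) →
      ∃ u ∈ unitaryGroupOfForm σ J, ∃ k ∈ glInt n E, h = u * k)
    (g : GL (Fin n) E) (hg : ∃ J' ∈ glInt n E, c • (J' : Matrix (Fin n) (Fin n) E) = formCongr σ g J) (γ : GL (Fin n) E)
    (hγ : (Submodule.span 𝒪[E] (Set.range ((g : Matrix (Fin n) (Fin n) E))ᵀ)).map
        ((Matrix.toLin' (γ : Matrix (Fin n) (Fin n) E)).restrictScalars 𝒪[E]) =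
      Submodule.span 𝒪[E] (Set.range ((g : Matrix (Fin n) (Fin n) E))ᵀ)) :
    ∃ u ∈ unitaryGroupOfForm σ J, S⁻¹ * (u⁻¹ * γ * u) * S ∈ glInt n E := by
  obtain ⟨u, hu, hΛ⟩ := exists_mem_unitaryGroupOfForm_span_eq_of_modular_of_selfDualLocus σ J hc S hS hsd g hg
  refine ⟨u, hu, ?_⟩
  rw [hΛ, map_span_eq_self_iff_conj_mem] at hγ
  exact hγ

/-- **THE SECOND COLOUR in group currency**: under the self-dual locus hypothesis and a scaling similitude, if `g𝒪ⁿ` is `c`-modular and `γ` fixes it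
(`g⁻¹ γ g ∈ GL_n(𝒪)`), then `γ ∈ u · (S·GL_n(𝒪)·S⁻¹) · u⁻¹` for some `u ∈ U(J)`: `∃ u ∈ U(J), S⁻¹ (u⁻¹ γ u) S ∈ GL_n(𝒪)` (from `g = u S k`:
`S⁻¹(u⁻¹γu)S = k (g⁻¹γg) k⁻¹`).  This is the form the vertex-frame lemma of the support localisation feeds («`∃ g, ϖ•J′ = ᵗσ(g)Jg ∧ g⁻¹γg ∈ GL_n(𝒪)`»).
[cite: Kottwitz1988, §2] [cite: Jacobowitz1962, §7 Thm. 7.1] -/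
theorem exists_mem_unitaryGroupOfForm_conj_mem_glInt_of_modular_of_selfDualLocus (J : Matrix (Fin n) (Fin n) E) {c : E} (hc : c ≠ 0)
    (S : GL (Fin n) E) (hS : formCongr σ S J = c • J)
    (hsd : ∀ h : GL (Fin n) E, (∃ J' ∈ glInt n E, (J' : Matrix (Fin n) (Fin n) E) = formCongr σ h J) →
      ∃ u ∈ unitaryGroupOfForm σ J, ∃ k ∈ glInt n E, h = u * k)
    (g : GL (Fin n) E) (hg : ∃ J' ∈ glInt n E, c • (J' : Matrix (Fin n) (Fin n) E) = formCongr σ g J) (γ : GL (Fin n) E)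
    (hγg : g⁻¹ * γ * g ∈ glInt n E) :
    ∃ u ∈ unitaryGroupOfForm σ J, S⁻¹ * (u⁻¹ * γ * u) * S ∈ glInt n E := by
  obtain ⟨u, hu, k, hk, rfl⟩ := exists_mem_unitaryGroupOfForm_mul_mul_of_modular_of_selfDualLocus σ J hc S hS hsd g hg
  refine ⟨u, hu, ?_⟩
  have h : S⁻¹ * (u⁻¹ * γ * u) * S = k * ((u * S * k)⁻¹ * γ * (u * S * k)) * k⁻¹ := by
    simp only [mul_inv_rev, mul_assoc, mul_inv_cancel_left, mul_inv_cancel, mul_one]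
  rw [h]
  exact mul_mem (mul_mem hk hγg) (inv_mem hk)

/-- The same in the `K′`-token of ★ `IwahoriGLTwoVertexStabilizers` (`K¹ = (GL_n(𝒪)).map (conj S)`, ★ `mem_map_conj_iff`):
`∃ u ∈ U(J), u⁻¹ γ u ∈ (glInt n E).map (MulAut.conj S)`. [cite: Kottwitz1988, §2] -/
theorem exists_mem_unitaryGroupOfForm_conj_mem_map_conj_of_modular_of_selfDualLocus (J : Matrix (Fin n) (Fin n) E) {c : E} (hc : c ≠ 0)
    (S : GL (Fin n) E) (hS : formCongr σ S J = c • J)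
    (hsd : ∀ h : GL (Fin n) E, (∃ J' ∈ glInt n E, (J' : Matrix (Fin n) (Fin n) E) = formCongr σ h J) →
      ∃ u ∈ unitaryGroupOfForm σ J, ∃ k ∈ glInt n E, h = u * k)
    (g : GL (Fin n) E) (hg : ∃ J' ∈ glInt n E, c • (J' : Matrix (Fin n) (Fin n) E) = formCongr σ g J) (γ : GL (Fin n) E)
    (hγg : g⁻¹ * γ * g ∈ glInt n E) :
    ∃ u ∈ unitaryGroupOfForm σ J, u⁻¹ * γ * u ∈ (glInt n E).map (MulAut.conj S).toMonoidHom := by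
  obtain ⟨u, hu, h⟩ := exists_mem_unitaryGroupOfForm_conj_mem_glInt_of_modular_of_selfDualLocus σ J hc S hS hsd g hg γ hγg
  exact ⟨u, hu, (Literature.GroupTheory.mem_map_conj_iff _ _ _).2 h⟩

/-- **On the group carrier `↥U(J)`**: with `K¹ := ((GL_n(𝒪)).map (conj S)).subgroupOf U(J)`, an element `γ ∈ U(J)` fixing a `c`-modular lattice is
`y k y⁻¹` with `y : ↥U(J)`, `k ∈ K¹` — i.e. `γ ∈ ⋃_y y K¹ y⁻¹`, the second half of the support localisation cover. [cite: Kottwitz1988, §2] -/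
theorem exists_eq_mul_mul_inv_of_modular_of_selfDualLocus (J : Matrix (Fin n) (Fin n) E) {c : E} (hc : c ≠ 0)
    (S : GL (Fin n) E) (hS : formCongr σ S J = c • J)
    (hsd : ∀ h : GL (Fin n) E, (∃ J' ∈ glInt n E, (J' : Matrix (Fin n) (Fin n) E) = formCongr σ h J) →
      ∃ u ∈ unitaryGroupOfForm σ J, ∃ k ∈ glInt n E, h = u * k)
    (g : GL (Fin n) E) (hg : ∃ J' ∈ glInt n E, c • (J' : Matrix (Fin n) (Fin n) E) = formCongr σ g J)
    (γ : ↥(unitaryGroupOfForm σ J)) (hγg : g⁻¹ * (γ : GL (Fin n) E) * g ∈ glInt n E) :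
    ∃ y : ↥(unitaryGroupOfForm σ J), ∃ k ∈ ((glInt n E).map (MulAut.conj S).toMonoidHom).subgroupOf (unitaryGroupOfForm σ J),
      γ = y * k * y⁻¹ := by
  obtain ⟨u, hu, h⟩ := exists_mem_unitaryGroupOfForm_conj_mem_map_conj_of_modular_of_selfDualLocus σ J hc S hS hsd g hg γ hγg
  refine ⟨⟨u, hu⟩, ⟨u, hu⟩⁻¹ * γ * ⟨u, hu⟩, ?_, ?_⟩
  · rw [Subgroup.mem_subgroupOf]
    exact h
  · simp only [mul_assoc, mul_inv_cancel_left, mul_inv_cancel, mul_one]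

end Generic

/-! ## §4 Discharging the self-dual locus hypothesis (the three ★ specialisations) -/

section Discharge

variable {E : Type*} [Field E] [ValuativeRel E] (σ : E →+* E) {n : ℕ}

/-- **ϖ-modular transitivity, hypothesis-driven form** (Jacobowitz's (trace) `b + σb = 1` and (norm) «`σ`-fixed units are norms» on `𝒪 = 𝒪[E]`, `σ` an
involution preserving `𝒪`; `J ∈ GL_n(𝒪)` `σ`-hermitian; `ᵗσ(S) J S = c • J`, `c ≠ 0`): `ᵗσ(g) J g ∈ c · GL_n(𝒪) ⇒ g = u S k`, `u ∈ U(J)`, `k ∈ GL_n(𝒪)`.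
[cite: Jacobowitz1962, §7 Thm. 7.1] [cite: Kottwitz1992, §7 Lemma 7.2, Cor. 7.3] -/
theorem exists_mem_unitaryGroupOfForm_mul_mul_of_modular (hσσ : ∀ x, σ (σ x) = x) (hσO : ∀ x : 𝒪[E], σ x ∈ 𝒪[E])
    (htr : ∃ b : 𝒪[E], (b : E) + σ b = 1)
    (hnorm : ∀ u : 𝒪[E], IsUnit u → σ u = u → ∃ t : 𝒪[E], (t : E) * σ t = u)
    (J : GL (Fin n) E) (hJ : J ∈ glInt n E) (hJh : ((J : Matrix (Fin n) (Fin n) E).map σ)ᵀ = J) {c : E} (hc : c ≠ 0)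
    (S : GL (Fin n) E) (hS : formCongr σ S (J : Matrix (Fin n) (Fin n) E) = c • (J : Matrix (Fin n) (Fin n) E))
    (g : GL (Fin n) E) (hg : ∃ J' ∈ glInt n E, c • (J' : Matrix (Fin n) (Fin n) E) = formCongr σ g (J : Matrix (Fin n) (Fin n) E)) :
    ∃ u ∈ unitaryGroupOfForm σ (J : Matrix (Fin n) (Fin n) E), ∃ k ∈ glInt n E, g = u * S * k :=
  exists_mem_unitaryGroupOfForm_mul_mul_of_modular_of_selfDualLocus σ (J : Matrix (Fin n) (Fin n) E) hc S hS
    (exists_mem_unitaryGroupOfForm_mul_of_selfDual σ hσσ hσO htr hnorm J hJ hJh) g hg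

end Discharge

section LocalField

variable {E : Type*} [Field E] [ValuativeRel E] [UniformSpace E] [IsUniformAddGroup E] [IsNonarchimedeanLocalField E]
  (σ : E →+* E) {n : ℕ}

/-- **ϖ-modular transitivity over a non-archimedean local field**, `σ` an involution preserving `𝒪` and residually non-trivial (`σ a − a` a unit for
some `a ∈ 𝒪`), `J ∈ GL_n(𝒪)` `σ`-hermitian, `ᵗσ(S) J S = c • J`, `c ≠ 0`: `ᵗσ(g) J g ∈ c · GL_n(𝒪) ⇒ g = u S k`. [cite: Jacobowitz1962, §7 Thm. 7.1]
[cite: Serre1979, Ch. V §2 Prop. 3] -/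
theorem exists_mem_unitaryGroupOfForm_mul_mul_of_modular_of_isUnit_sub (hσσ : ∀ x, σ (σ x) = x)
    (hσO : ∀ x : 𝒪[E], σ x ∈ 𝒪[E]) (a : 𝒪[E]) (ha : IsUnit ((⟨σ a, hσO a⟩ : 𝒪[E]) - a))
    (J : GL (Fin n) E) (hJ : J ∈ glInt n E) (hJh : ((J : Matrix (Fin n) (Fin n) E).map σ)ᵀ = J) {c : E} (hc : c ≠ 0)
    (S : GL (Fin n) E) (hS : formCongr σ S (J : Matrix (Fin n) (Fin n) E) = c • (J : Matrix (Fin n) (Fin n) E))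
    (g : GL (Fin n) E) (hg : ∃ J' ∈ glInt n E, c • (J' : Matrix (Fin n) (Fin n) E) = formCongr σ g (J : Matrix (Fin n) (Fin n) E)) :
    ∃ u ∈ unitaryGroupOfForm σ (J : Matrix (Fin n) (Fin n) E), ∃ k ∈ glInt n E, g = u * S * k :=
  exists_mem_unitaryGroupOfForm_mul_mul_of_modular_of_selfDualLocus σ (J : Matrix (Fin n) (Fin n) E) hc S hS
    (exists_mem_unitaryGroupOfForm_mul_of_selfDual_of_isUnit_sub σ hσσ hσO a ha J hJ hJh) g hg

end LocalField

section NumberField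

variable {F E : Type} [Field F] [NumberField F] [Field E] [NumberField E] [Algebra F E]
  [Algebra.IsQuadraticExtension F E] (c : E ≃ₐ[F] E) {v : HeightOneSpectrum (𝓞 F)} (w : PlacesOver E v)

/-- **`U(J)(E_w)` is transitive on ϖ-modular `𝒪_w`-lattices at an INERT place** (`v` unramified in `E`, `w ∣ v` with `c • w = w`, `c ≠ 1`, any residue
characteristic), for the local Galois involution `σ_w = galAdicCompletionMap c hw`, a `σ_w`-hermitian `J ∈ GL_N(𝒪_w)` and a scaling similitude `S`
(`ᵗσ_w(S) J S = ϖ • J`, `ϖ ≠ 0` — for `(Φ₂)_w`: `S = diag(1, ϖ_w)`): every `g ∈ GL_N(E_w)` with `ᵗσ_w(g) J g ∈ ϖ · GL_N(𝒪_w)` is `u S k`, `u ∈ U(J)(E_w)`,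
`k ∈ GL_N(𝒪_w)`; hence (§3) the ϖ-modular lattices form ONE `U(J)(E_w)`-orbit and their stabilisers in `U(J)(E_w)` are the conjugates of
`K¹ = U(J)(E_w) ∩ S·GL_N(𝒪_w)·S⁻¹`. [cite: Jacobowitz1962, §7 Thm. 7.1] [cite: Kottwitz1988, §2] [cite: Kottwitz1992, §7 Cor. 7.3] -/
theorem exists_mem_unitaryGroupOfForm_mul_mul_of_modular_of_nonsplit (hc1 : c ≠ 1) (hw : c • w.1 = w.1)
    (hv : Algebra.IsUnramifiedIn (𝓞 E) v.asIdeal) {N : ℕ}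
    (J : GL (Fin N) (w.1.adicCompletion E)) (hJ : J ∈ glInt N (w.1.adicCompletion E))
    (hJh : ((J : Matrix (Fin N) (Fin N) (w.1.adicCompletion E)).map (galAdicCompletionMap (L := E) c hw))ᵀ = J)
    {ϖ : w.1.adicCompletion E} (hϖ : ϖ ≠ 0) (S : GL (Fin N) (w.1.adicCompletion E))
    (hS : formCongr (galAdicCompletionMap (L := E) c hw) S (J : Matrix (Fin N) (Fin N) (w.1.adicCompletion E)) =
      ϖ • (J : Matrix (Fin N) (Fin N) (w.1.adicCompletion E)))
    (g : GL (Fin N) (w.1.adicCompletion E))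
    (hg : ∃ J' ∈ glInt N (w.1.adicCompletion E), ϖ • (J' : Matrix (Fin N) (Fin N) (w.1.adicCompletion E)) =
      formCongr (galAdicCompletionMap (L := E) c hw) g (J : Matrix (Fin N) (Fin N) (w.1.adicCompletion E))) :
    ∃ u ∈ unitaryGroupOfForm (galAdicCompletionMap (L := E) c hw) (J : Matrix (Fin N) (Fin N) (w.1.adicCompletion E)),
      ∃ k ∈ glInt N (w.1.adicCompletion E), g = u * S * k :=
  exists_mem_unitaryGroupOfForm_mul_mul_of_modular_of_selfDualLocus (galAdicCompletionMap (L := E) c hw)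
    (J : Matrix (Fin N) (Fin N) (w.1.adicCompletion E)) hϖ S hS
    (exists_mem_unitaryGroupOfForm_mul_of_selfDual_of_nonsplit c w hc1 hw hv J hJ hJh) g hg

end NumberField

end Literature.NumberTheory.Automorphic.UnitaryGroup
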